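import Summits.BirchSwinnertonDyer.Rank1Residual.GaloisImage.NineDivisionFrobeniusListPoly
import Mathlib.AlgebraicGeometry.EllipticCurve.DivisionPolynomial.Basic
import Mathlib.FieldTheory.IsAlgClosed.AlgebraicClosure
import Mathlib.Tactic.NormNum.Prime
import HarnessLib

/-!
# A KERNEL-DECIDABLE certificate that the `9`-division polynomial of an integer model has, modulo a
# prime `ℓ`, a root OUTSIDE `𝔽_{ℓ³}` — the finite-field half of a Frobenius ORDER-`9` certificate
# (cell `b2b-bsdres`, team n1011, seat p03 gen 6 — idea 'T-b11-FROB9' part 1; r1 ROUTE-1 §31 'SUPPORTS')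

HONEST FRAMING (cell `b2b-bsdres`, run/shared/lean/b2b/bsd-rank1-residual/, verbatim in every
file): the goal of the cell is to DELETE the COMBINATION-SHAPED residual classes of the
Birch–Swinnerton-Dyer formula for ALL analytic-rank `≤ 1` elliptic curves over `ℚ` — "full BSD
formula for every rank `≤ 1` curve in class `C`" assembled STRICTLY from published theorems — so
that the rank-`≤ 1` remainder becomes exactly the CONSTRUCTION-SHAPED classes, which are TYPED
(missing-input `Prop`s), NOT attempted. This is not "finishing BSD". Team n1011 (N10 / N11):
research route; no claim beyond the stated classes; labels UNCHANGED; nothing is booked. This file is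
a COMPUTABLE CERTIFICATE CHECKER with its soundness theorem (definitions = list arithmetic only; no
named fact); it proves nothing about any Galois representation by itself.

(The kernel-checked SELF-TEST — 5400bu1 at `ℓ = 13`, `m = 6` — lives in the sibling file
`NineDivisionFrobeniusCertificate5400bu1.lean` for the 400-line rule.)

## Why

n1011-p02's F0 `towerSurj_three_of_surj_of_orderNine` (p266894) gives the whole `3`-adic tower from
`ρ̄_{E,3}` onto + ONE `σ ∈ Γ_ℚ` with `σ³ = 1` on `E[3]` and `σ³ ≠ 1` on `E[9]`.  On the 341 EXOTIC
CANDIDATE cells the natural `σ` is a Frobenius at a good prime `ℓ ≡ 1 (mod 3)`; p02's census finds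
one for 321/321 non-Elkies candidates (`m3/M3-LOCAL-NOTE.md` §3: `ψ₉/ψ₃ mod ℓ` has an irreducible
factor of degree `9` or `18`) — as EVIDENCE (a PARI factorisation).  The trace/determinant of
Frobenius CANNOT certify this (every `σ ≡` unipotent `(mod 3)` has `27 ∣ det(σ³ − 1)`: order `9` and
order `3` share characteristic polynomials), so a kernel certificate must see the `9`-division
polynomial.  This file supplies the decidable core:

  CERTIFICATE `(g, h, chain, u, v; chainX, chainD)` over `𝔽_ℓ` (lists of integers):
  `g · h = preΨ₉(E₀ mod ℓ)`; `chain` = square-and-multiply steps `r ↦ r²` / `r ↦ r·X` with quotients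
  mod `g`, from `r₀ = X` to exponent `ℓ^m` (`m = 3` or `6`), each step `s = q·g + r'` an identity;
  `u·g + v·(r_final − X) = 1`; `g` non-constant; `chainX`: `X^{ℓ^m} ≡ X (mod Ψ₃)`; `chainD`:
  `Ψ₂Sq^{(ℓ^m−1)/2} ≡ 1 (mod Ψ₃)`.

* (file A, `NineDivisionFrobeniusListPoly`: `Frob9.toPoly ℓ : List ℤ → (ZMod ℓ)[X]` and the
  ring-homomorphism lemmas for the list arithmetic);
* `Frob9.prePsi9L ℓ E₀` — Mathlib's `preΨ' 9` (`preNormEDS'` recursion: `preΨ'_odd`/`preΨ'_even` at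
  `n = 5, 6, 9`) computed on lists; `toPoly_prePsi9L : toPoly ℓ (prePsi9L ℓ E₀) = (E₀ mod ℓ).preΨ' 9`;
* `Frob9.check9 / check3 / check ℓ E₀ m … : Bool` and the soundness theorems
  **`exists_root_pow_ne_of_check9`** (any algebraically closed `K ⊇ 𝔽_ℓ`: some `x₀` with
  `preΨ₉(E₀ mod ℓ)(x₀) = 0`, `x₀^{ℓ^m} ≠ x₀` — a `9`-division abscissa outside `𝔽_{ℓ^m}`, so the Frobenius
  `φ` has `φ^m ≠ 1` on `Ẽ[9]`) and **`pow_eq_of_check3`** (any `𝔽_ℓ`-algebra `K`: every root `x₀` of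
  `Ψ₃(E₀ mod ℓ)` has `x₀^{ℓ^m} = x₀` and `Ψ₂Sq(x₀)^{(ℓ^m−1)/2} = 1` — every `3`-torsion point of `Ẽ` is
  `𝔽_{ℓ^m}`-rational, so `φ^m = 1` on `Ẽ[3]`); `m = 3` (`a_ℓ ≡ 2 (mod 3)`, F0's `τ = σ`) or `m = 6`
  (`a_ℓ ≡ 1`, `τ = σ²`); `exists_root_pow_ne_of_check` = the `ψ₉` statement over `𝔽̄_ℓ` from `check`.

Consumers (part 2, not here): `x₀` is the abscissa of a point `P ∈ Ẽ(𝔽̄_ℓ)` with `9P = 0`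
(`zsmul_eq_zero_iff_evalEval_ψ_holds`) and `φ^m P ≠ P`; transported to `E[9]` along
`exists_reduceTorsionHom` this is F0's `τ³ ≠ 1 on E[9]` for `τ = σ` (`m = 3`, `a_ℓ ≡ 2 (mod 3)`:
`σ` unipotent on `E[3]`) or `τ = σ²` (`m = 6`, `a_ℓ ≡ 1 (mod 3)`: `σ ≡ −`unipotent, `σ⁶ = 1` on `E[3]`).
(On the 321 non-Elkies candidates: 171 rows with `a_ℓ ≡ 2`, 150 with `a_ℓ ≡ 1` at p02's prime.)  Nothing booked; X4 CONSTRUCTION-SHAPED.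

References: [SilvermanAEC2009] Exercise 3.7 (division polynomials); [Washington2008] §3.2;
Mathlib `WeierstrassCurve.preΨ'`.
-/

open Polynomial

namespace Summit.BirchSwinnertonDyer.Rank1Residual.GaloisImage.Frob9

/-! ### §2 Mathlib's `preΨ' 9` on lists -/

section DivisionPolynomial

variable (ℓ : ℕ) (E₀ : WeierstrassCurve ℤ)

/-- `Ψ₂Sq = 4X³ + b₂X² + 2b₄X + b₆` as a list. [folklore] -/
def psi2sqL : List ℤ := [E₀.b₆, 2 * E₀.b₄, E₀.b₂, 4]

/-- `Ψ₃ = 3X⁴ + b₂X³ + 3b₄X² + 3b₆X + b₈` as a list. [folklore] -/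
def psi3L : List ℤ := [E₀.b₈, 3 * E₀.b₆, 3 * E₀.b₄, E₀.b₂, 3]

/-- `preΨ₄ = 2X⁶ + b₂X⁵ + 5b₄X⁴ + 10b₆X³ + 10b₈X² + (b₂b₈ − b₄b₆)X + (b₄b₈ − b₆²)` as a list. [folklore] -/
def prePsi4L : List ℤ :=
  [E₀.b₄ * E₀.b₈ - E₀.b₆ ^ 2, E₀.b₂ * E₀.b₈ - E₀.b₄ * E₀.b₆, 10 * E₀.b₈, 10 * E₀.b₆, 5 * E₀.b₄,
    E₀.b₂, 2]

/-- `preΨ₅ = preΨ₄·Ψ₂Sq² − Ψ₃³` as a reduced list. [folklore] -/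
def prePsi5L : List ℤ :=
  reduceL ℓ (subL (mulR ℓ (prePsi4L E₀) (powR ℓ (psi2sqL E₀) 2)) (powR ℓ (psi3L E₀) 3))

/-- `preΨ₆ = Ψ₃·preΨ₅ − Ψ₃·preΨ₄²` as a reduced list. [folklore] -/
def prePsi6L : List ℤ :=
  reduceL ℓ (subL (mulR ℓ (psi3L E₀) (prePsi5L ℓ E₀)) (mulR ℓ (psi3L E₀) (powR ℓ (prePsi4L E₀) 2)))

/-- `preΨ₉ = preΨ₆·preΨ₄³·Ψ₂Sq² − Ψ₃·preΨ₅³` as a reduced list. [folklore] -/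
def prePsi9L : List ℤ :=
  reduceL ℓ (subL (mulR ℓ (mulR ℓ (prePsi6L ℓ E₀) (powR ℓ (prePsi4L E₀) 3)) (powR ℓ (psi2sqL E₀) 2))
    (mulR ℓ (psi3L E₀) (powR ℓ (prePsi5L ℓ E₀) 3)))

variable {ℓ E₀}

/-- `toPoly psi2sqL = Ψ₂Sq` of the reduced curve. [folklore] -/
theorem toPoly_psi2sqL : toPoly ℓ (psi2sqL E₀) = (E₀.map (Int.castRingHom (ZMod ℓ))).Ψ₂Sq := by
  simp only [psi2sqL, toPoly_cons, toPoly_nil, WeierstrassCurve.Ψ₂Sq, WeierstrassCurve.map_b₂,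
    WeierstrassCurve.map_b₄, WeierstrassCurve.map_b₆, eq_intCast]
  push_cast
  simp only [map_ofNat, C_mul]
  ring

/-- `toPoly psi3L = Ψ₃` of the reduced curve. [folklore] -/
theorem toPoly_psi3L : toPoly ℓ (psi3L E₀) = (E₀.map (Int.castRingHom (ZMod ℓ))).Ψ₃ := by
  simp only [psi3L, toPoly_cons, toPoly_nil, WeierstrassCurve.Ψ₃, WeierstrassCurve.map_b₂,
    WeierstrassCurve.map_b₄, WeierstrassCurve.map_b₆, WeierstrassCurve.map_b₈, eq_intCast]
  push_cast
  simp only [C_mul, map_ofNat]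
  ring

/-- `toPoly prePsi4L = preΨ₄` of the reduced curve. [folklore] -/
theorem toPoly_prePsi4L : toPoly ℓ (prePsi4L E₀) = (E₀.map (Int.castRingHom (ZMod ℓ))).preΨ₄ := by
  simp only [prePsi4L, toPoly_cons, toPoly_nil, WeierstrassCurve.preΨ₄, WeierstrassCurve.map_b₂,
    WeierstrassCurve.map_b₄, WeierstrassCurve.map_b₆, WeierstrassCurve.map_b₈, eq_intCast]
  push_cast
  simp only [C_mul, C_sub, C_pow, map_ofNat]
  ring

section preΨlemmas

variable {R : Type*} [CommRing R] (W : WeierstrassCurve R)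

/-- `preΨ₅ = preΨ₄ Ψ₂Sq² − Ψ₃³` (Mathlib's `preΨ'_odd` at `m = 0`). [folklore] -/
theorem preΨ'_five : W.preΨ' 5 = W.preΨ₄ * W.Ψ₂Sq ^ 2 - W.Ψ₃ ^ 3 := by
  have h := W.preΨ'_odd 0
  norm_num at h
  rw [h]

/-- `preΨ₆ = Ψ₃ preΨ₅ − Ψ₃ preΨ₄²` (Mathlib's `preΨ'_even` at `m = 0`). [folklore] -/
theorem preΨ'_six : W.preΨ' 6 = W.Ψ₃ * W.preΨ' 5 - W.Ψ₃ * W.preΨ₄ ^ 2 := by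
  have h := W.preΨ'_even 0
  norm_num at h
  rw [h]

/-- `preΨ₉ = preΨ₆ preΨ₄³ Ψ₂Sq² − Ψ₃ preΨ₅³` (Mathlib's `preΨ'_odd` at `m = 2`). [folklore] -/
theorem preΨ'_nine : W.preΨ' 9 = W.preΨ' 6 * W.preΨ₄ ^ 3 * W.Ψ₂Sq ^ 2 - W.Ψ₃ * W.preΨ' 5 ^ 3 := by
  have h := W.preΨ'_odd 2
  norm_num at h
  rw [h]

end preΨlemmas

/-- `toPoly prePsi5L = preΨ' 5` of the reduced curve. [folklore] -/
theorem toPoly_prePsi5L : toPoly ℓ (prePsi5L ℓ E₀) = (E₀.map (Int.castRingHom (ZMod ℓ))).preΨ' 5 := by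
  rw [prePsi5L, toPoly_reduceL, toPoly_subL, toPoly_mulR, toPoly_powR, toPoly_powR, toPoly_prePsi4L,
    toPoly_psi2sqL, toPoly_psi3L, preΨ'_five]

/-- `toPoly prePsi6L = preΨ' 6` of the reduced curve. [folklore] -/
theorem toPoly_prePsi6L : toPoly ℓ (prePsi6L ℓ E₀) = (E₀.map (Int.castRingHom (ZMod ℓ))).preΨ' 6 := by
  rw [prePsi6L, toPoly_reduceL, toPoly_subL, toPoly_mulR, toPoly_mulR, toPoly_powR, toPoly_prePsi5L,
    toPoly_prePsi4L, toPoly_psi3L, preΨ'_six]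

/-- **`toPoly prePsi9L = preΨ' 9` of the reduced curve** `E₀ mod ℓ`. [folklore] -/
theorem toPoly_prePsi9L : toPoly ℓ (prePsi9L ℓ E₀) = (E₀.map (Int.castRingHom (ZMod ℓ))).preΨ' 9 := by
  rw [prePsi9L, toPoly_reduceL, toPoly_subL, toPoly_mulR, toPoly_mulR, toPoly_mulR, toPoly_powR,
    toPoly_powR, toPoly_powR, toPoly_prePsi6L, toPoly_prePsi5L, toPoly_prePsi4L, toPoly_psi2sqL,
    toPoly_psi3L, preΨ'_nine]

end DivisionPolynomial

/-! ### §3 The certificate checker and its soundness -/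

section Check

variable (ℓ : ℕ)

/-- One square-and-multiply step of a chain modulo `g` with base `b`: from the current remainder `r`
and exponent `e`, a step `(true, q, r')` claims `r² = q·g + r'` (exponent `2e`), a step `(false, q, r')`
claims `r·b = q·g + r'` (exponent `e + 1`).  Returns the final `(r, e)` if every claimed identity holds
mod `ℓ`, else `none`. [folklore] -/
def runChain (g b : List ℤ) : List ℤ → ℕ → List (Bool × List ℤ × List ℤ) → Option (List ℤ × ℕ)
  | r, e, [] => some (r, e)
  | r, e, (true, q, r') :: rest =>
    if eqModL ℓ (mulR ℓ r r) (addL (mulR ℓ q g) r') then runChain g b r' (2 * e) rest else none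
  | r, e, (false, q, r') :: rest =>
    if eqModL ℓ (mulR ℓ r b) (addL (mulR ℓ q g) r') then runChain g b r' (e + 1) rest else none

/-- **The `ψ₉` part of the checker**: `g·h = preΨ₉(E₀)`, `g` non-constant, the chain (base `X`) runs
from `(X, 1)` to `(r, ℓ^m)` and `u·g + v·(r − X) = 1` — all identities mod `ℓ`. [folklore] -/
def check9 (E₀ : WeierstrassCurve ℤ) (m : ℕ) (g h : List ℤ) (chain : List (Bool × List ℤ × List ℤ))
    (u v : List ℤ) : Bool :=
  eqModL ℓ (mulR ℓ g h) (prePsi9L ℓ E₀) &&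
  nonConstL ℓ g &&
  match runChain ℓ g [0, 1] [0, 1] 1 chain with
  | none => false
  | some (r, e) => (e == ℓ ^ m) && eqModL ℓ (addL (mulR ℓ u g) (mulR ℓ v (subL r [0, 1]))) [1]

/-- **The `ψ₃` part of the checker** (all `3`-torsion of the reduced curve is `𝔽_{ℓ^m}`-rational):
modulo `Ψ₃(E₀)`, the chain with base `X` runs from `(X, 1)` to `(X, ℓ^m)` (`X^{ℓ^m} ≡ X`) and the chain
with base `Ψ₂Sq(E₀)` runs from `(Ψ₂Sq, 1)` to `(1, e)` with `2e + 1 = ℓ^m` (`Ψ₂Sq^{(ℓ^m−1)/2} ≡ 1`: the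
ordinates are rational too). [folklore] -/
def check3 (E₀ : WeierstrassCurve ℤ) (m : ℕ) (chainX chainD : List (Bool × List ℤ × List ℤ)) : Bool :=
  (match runChain ℓ (psi3L E₀) [0, 1] [0, 1] 1 chainX with
    | none => false
    | some (r, e) => (e == ℓ ^ m) && eqModL ℓ r [0, 1]) &&
  (match runChain ℓ (psi3L E₀) (psi2sqL E₀) (psi2sqL E₀) 1 chainD with
    | none => false
    | some (r, e) => (2 * e + 1 == ℓ ^ m) && eqModL ℓ r [1])

/-- **The certificate checker** (`m = 3` when `a_ℓ ≡ 2 (mod 3)`: Frobenius unipotent on `E[3]`, F0's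
witness `τ = σ`; `m = 6` when `a_ℓ ≡ 1 (mod 3)`: minus a unipotent, `τ = σ²`): the `ψ₉` part (some
`9`-division abscissa is NOT in `𝔽_{ℓ^m}`) and the `ψ₃` part (every `3`-torsion point IS `𝔽_{ℓ^m}`-rational).
[folklore] -/
def check (E₀ : WeierstrassCurve ℤ) (m : ℕ) (g h : List ℤ) (chain : List (Bool × List ℤ × List ℤ))
    (u v : List ℤ) (chainX chainD : List (Bool × List ℤ × List ℤ)) : Bool :=
  check9 ℓ E₀ m g h chain u v && check3 ℓ E₀ m chainX chainD

variable {ℓ}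

/-- Chain invariant: if `b^e ≡ toPoly r (mod toPoly g)` and the chain runs to `(r', e')`, then
`b^{e'} ≡ toPoly r' (mod toPoly g)`, `b = toPoly base`. [folklore] -/
theorem runChain_sound (g base : List ℤ) :
    ∀ (chain : List (Bool × List ℤ × List ℤ)) (r : List ℤ) (e : ℕ) (r' : List ℤ) (e' : ℕ),
      runChain ℓ g base r e chain = some (r', e') →
      (∃ w : (ZMod ℓ)[X], toPoly ℓ base ^ e = toPoly ℓ g * w + toPoly ℓ r) →
      ∃ w : (ZMod ℓ)[X], toPoly ℓ base ^ e' = toPoly ℓ g * w + toPoly ℓ r'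
  | [], r, e, r', e', h, hw => by
    simp only [runChain, Option.some.injEq, Prod.mk.injEq] at h
    obtain ⟨rfl, rfl⟩ := h
    exact hw
  | (true, q, r₁) :: rest, r, e, r', e', h, hw => by
    simp only [runChain] at h
    split_ifs at h with hstep
    obtain ⟨w, hw⟩ := hw
    have hid := toPoly_eq_of_eqModL hstep
    rw [toPoly_addL, toPoly_mulR, toPoly_mulR] at hid
    refine runChain_sound g base rest r₁ _ r' e' h
      ⟨toPoly ℓ g * w ^ 2 + 2 * w * toPoly ℓ r + toPoly ℓ q, ?_⟩
    have key : (toPoly ℓ g * w + toPoly ℓ r) ^ 2 =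
        toPoly ℓ g * (toPoly ℓ g * w ^ 2 + 2 * w * toPoly ℓ r) + toPoly ℓ r * toPoly ℓ r := by ring
    calc (toPoly ℓ base) ^ (2 * e) = (toPoly ℓ base ^ e) ^ 2 := by ring
      _ = _ := by rw [hw, key, hid]; ring
  | (false, q, r₁) :: rest, r, e, r', e', h, hw => by
    simp only [runChain] at h
    split_ifs at h with hstep
    obtain ⟨w, hw⟩ := hw
    have hid := toPoly_eq_of_eqModL hstep
    rw [toPoly_addL, toPoly_mulR, toPoly_mulR] at hid
    refine runChain_sound g base rest r₁ _ r' e' h ⟨w * toPoly ℓ base + toPoly ℓ q, ?_⟩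
    have key : (toPoly ℓ g * w + toPoly ℓ r) * toPoly ℓ base =
        toPoly ℓ g * (w * toPoly ℓ base) + toPoly ℓ r * toPoly ℓ base := by ring
    calc (toPoly ℓ base) ^ (e + 1) = toPoly ℓ base ^ e * toPoly ℓ base := pow_succ _ _
      _ = _ := by rw [hw, key, hid]; ring

/-- `toPoly [0, 1] = X`. [folklore] -/
theorem toPoly_X : toPoly ℓ [0, 1] = X := by
  simp [toPoly_cons, toPoly_nil]

/-- **SOUNDNESS of the `ψ₉` part.**  Over any algebraically closed field `K ⊇ 𝔽_ℓ` (`ℓ` prime): if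
`check9 ℓ E₀ m g h chain u v = true` there is `x₀ ∈ K` with `preΨ₉(E₀ mod ℓ)(x₀) = 0` and
`x₀^{ℓ^m} ≠ x₀` — a `9`-division abscissa of the reduced curve NOT defined over `𝔽_{ℓ^m}`: `x₀` is a
root of `g ∣ preΨ₉`; `X^{ℓ^m} ≡ r (mod g)` by the chain, so `x₀^{ℓ^m} = r(x₀)`; and
`u g + v (r − X) = 1` evaluated at `x₀` forbids `r(x₀) = x₀`. [folklore] -/
theorem exists_root_pow_ne_of_check9 [Fact ℓ.Prime] (K : Type*) [Field K] [IsAlgClosed K]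
    [Algebra (ZMod ℓ) K] {E₀ : WeierstrassCurve ℤ} {m : ℕ} {g h u v : List ℤ}
    {chain : List (Bool × List ℤ × List ℤ)} (hc : check9 ℓ E₀ m g h chain u v = true) :
    ∃ x₀ : K, ((E₀.map (Int.castRingHom (ZMod ℓ))).preΨ' 9).aeval x₀ = 0 ∧ x₀ ^ (ℓ ^ m) ≠ x₀ := by
  simp only [check9, Bool.and_eq_true] at hc
  obtain ⟨⟨hgh, hg⟩, hrest⟩ := hc
  cases hrun : runChain ℓ g [0, 1] [0, 1] 1 chain with
  | none => rw [hrun] at hrest; exact Bool.noConfusion hrest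
  | some re =>
    obtain ⟨r, e⟩ := re
    rw [hrun] at hrest
    simp only [Bool.and_eq_true, beq_iff_eq] at hrest
    obtain ⟨he, hbez⟩ := hrest
    have hdeg : ((toPoly ℓ g).map (algebraMap (ZMod ℓ) K)).degree ≠ 0 := by
      rw [degree_map]; exact degree_toPoly_ne_zero_of_nonConstL hg
    obtain ⟨x₀, hx₀⟩ := IsAlgClosed.exists_root _ hdeg
    have hGx : aeval x₀ (toPoly ℓ g) = 0 := by rwa [IsRoot.def, eval_map, ← aeval_def] at hx₀
    refine ⟨x₀, ?_, ?_⟩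
    · have hfac : (E₀.map (Int.castRingHom (ZMod ℓ))).preΨ' 9 = toPoly ℓ g * toPoly ℓ h := by
        rw [← toPoly_prePsi9L, ← toPoly_mulR]; exact (toPoly_eq_of_eqModL hgh).symm
      rw [hfac, map_mul, hGx, zero_mul]
    · obtain ⟨w, hw⟩ := runChain_sound g [0, 1] chain [0, 1] 1 r e hrun ⟨0, by simp⟩
      rw [he, toPoly_X] at hw
      have hb := toPoly_eq_of_eqModL hbez
      rw [toPoly_addL, toPoly_mulR, toPoly_mulR, toPoly_subL, toPoly_X] at hb
      simp only [toPoly_cons, toPoly_nil, Int.cast_one, C_1, mul_zero, add_zero] at hb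
      intro hx
      have h1 := congrArg (aeval x₀) hw
      have h2 := congrArg (aeval x₀) hb
      simp only [map_pow, aeval_X, map_add, map_mul, map_sub, map_one, hGx, zero_mul, zero_add,
        mul_zero] at h1 h2
      rw [← h1, hx, sub_self, mul_zero] at h2
      exact zero_ne_one h2

/-- **SOUNDNESS of the `ψ₃` part.**  Over any commutative `𝔽_ℓ`-algebra `K`: if
`check3 ℓ E₀ m chainX chainD = true` then every root `x₀ ∈ K` of `Ψ₃(E₀ mod ℓ)` satisfies
`x₀^{ℓ^m} = x₀` and `Ψ₂Sq(E₀ mod ℓ)(x₀)^e = 1` for the certified `e` with `2e + 1 = ℓ^m` — on the reduced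
curve: every `3`-torsion point has abscissa AND ordinate in `𝔽_{ℓ^m}` (`Ψ₂Sq = (2y + a₁x + a₃)²` on the
curve). [folklore] -/
theorem pow_eq_of_check3 [Fact ℓ.Prime] (K : Type*) [CommRing K] [Algebra (ZMod ℓ) K]
    {E₀ : WeierstrassCurve ℤ} {m : ℕ} {chainX chainD : List (Bool × List ℤ × List ℤ)}
    (hc : check3 ℓ E₀ m chainX chainD = true) :
    ∃ e : ℕ, 2 * e + 1 = ℓ ^ m ∧ ∀ x₀ : K, ((E₀.map (Int.castRingHom (ZMod ℓ))).Ψ₃).aeval x₀ = 0 →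
      x₀ ^ (ℓ ^ m) = x₀ ∧ (((E₀.map (Int.castRingHom (ZMod ℓ))).Ψ₂Sq).aeval x₀) ^ e = 1 := by
  simp only [check3, Bool.and_eq_true] at hc
  obtain ⟨hX, hD⟩ := hc
  cases hrunX : runChain ℓ (psi3L E₀) [0, 1] [0, 1] 1 chainX with
  | none => rw [hrunX] at hX; exact Bool.noConfusion hX
  | some reX =>
    obtain ⟨rX, eX⟩ := reX
    rw [hrunX] at hX
    simp only [Bool.and_eq_true, beq_iff_eq] at hX
    obtain ⟨heX, hrX⟩ := hX
    cases hrunD : runChain ℓ (psi3L E₀) (psi2sqL E₀) (psi2sqL E₀) 1 chainD with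
    | none => rw [hrunD] at hD; exact Bool.noConfusion hD
    | some reD =>
      obtain ⟨rD, eD⟩ := reD
      rw [hrunD] at hD
      simp only [Bool.and_eq_true, beq_iff_eq] at hD
      obtain ⟨heD, hrD⟩ := hD
      refine ⟨eD, heD, fun x₀ hx₀ => ?_⟩
      have h3x : aeval x₀ (toPoly ℓ (psi3L E₀)) = 0 := by rwa [toPoly_psi3L]
      obtain ⟨wX, hwX⟩ := runChain_sound (psi3L E₀) [0, 1] chainX [0, 1] 1 rX eX hrunX ⟨0, by simp⟩
      rw [heX, toPoly_X, toPoly_eq_of_eqModL hrX, toPoly_X] at hwX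
      obtain ⟨wD, hwD⟩ := runChain_sound (psi3L E₀) (psi2sqL E₀) chainD (psi2sqL E₀) 1 rD eD hrunD
        ⟨0, by simp⟩
      rw [toPoly_eq_of_eqModL hrD, toPoly_psi2sqL] at hwD
      simp only [toPoly_cons, toPoly_nil, Int.cast_one, C_1, mul_zero, add_zero] at hwD
      constructor
      · have h1 := congrArg (aeval x₀) hwX
        simpa [map_pow, aeval_X, map_add, map_mul, h3x] using h1
      · have h2 := congrArg (aeval x₀) hwD
        simpa [map_pow, map_add, map_mul, map_one, h3x] using h2

/-- The two soundness statements from the combined `check`, over an algebraic closure of `𝔽_ℓ`.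
[folklore] -/
theorem exists_root_pow_ne_of_check [Fact ℓ.Prime] {E₀ : WeierstrassCurve ℤ} {m : ℕ} {g h u v : List ℤ}
    {chain chainX chainD : List (Bool × List ℤ × List ℤ)}
    (hc : check ℓ E₀ m g h chain u v chainX chainD = true) :
    ∃ x₀ : AlgebraicClosure (ZMod ℓ),
      ((E₀.map (Int.castRingHom (ZMod ℓ))).preΨ' 9).aeval x₀ = 0 ∧ x₀ ^ (ℓ ^ m) ≠ x₀ := by
  simp only [check, Bool.and_eq_true] at hc
  exact exists_root_pow_ne_of_check9 (AlgebraicClosure (ZMod ℓ)) hc.1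

end Check

end Summit.BirchSwinnertonDyer.Rank1Residual.GaloisImage.Frob9
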